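import Summits.NavierStokesRegularity.FluidComputer.CollapseAnsatzResidualCurl
import Literature.Analysis.FluidPDE.CurlFreeLiouville
import Literature.Analysis.FluidPDE.NSEnstrophyPersistenceForced
import HarnessLib

/-!
# The exact collapse ansatz is never an E–C design, for EVERY exponent `γ ≠ ½` and EVERY pressure:
# a bounded-curl residual forces a harmonic vorticity profile

Cell `ns-blowup`, seat `ns-blowup-ecbridge-2` (g4; the E–C endpoint theory seat). LABEL: E–C typing
(KERNEL, FACT-FREE; theorems only). WHAT THIS IS NOT: not Navier–Stokes evidence — a necessary
condition on a DESIGN; nothing is constructed. Part 2 of 2 (part 1: `CollapseAnsatzResidualCurl.lean`).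
Companion memos: `run/shared/lean/pub/ns-blowup/ecbridge2/ECBRIDGE-2-MEMO-2.md` §3 and `…-MEMO-3.md`.

## Content (MEMO-2 §3 (0), the order-zero obstruction, made unconditional and pressure-free)

The seat's g3 file `EulerWindowClayForce.lean` showed: if `U` IS an exact self-similar Euler profile,
the Navier–Stokes residual of `u(t,x) = (T−t)^{γ−1} U(x/(T−t)^γ)` is `−ν(T−t)^{−1−γ}ΔU(y)`, unbounded
unless `ΔU ≡ 0`. Here NOTHING is assumed about `U` except smoothness, and the pressure is ARBITRARY
(part 1: `curl(residual + ∇q) = (T−t)^{−2}·curl N(y) − ν(T−t)^{−1−2γ}·curl ΔU(y)`):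

* `curl_terms_eq_zero_at`, **`curl_laplacian_profile_eq_zero`** — if the curl of the residual of the
  exact collapse ansatz (any `γ ≠ ½`, `γ > −½`, any `ν ≠ 0`, any `C²` pressure field) is BOUNDED on
  `(t₁, T) × ℝ³`, then `curl ΔU ≡ 0` AND `curl N ≡ 0` (two-scale lemma on the powers `−2 ≠ −1−2γ`);
  **`curl_laplacian_profile_eq_zero_local`** — for `γ > 0` a bound on `(t₁, T) × B(0, ρ)` suffices
  (cut-off designs: every `x_t = (T−t)^γ y` enters the ball);
* `laplacian_curl_profile_eq_zero` — so `Δ(curl U) ≡ 0`: **the vorticity profile is harmonic**;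
* `curl_profile_eq_zero` (+ `curl U ∈ L^p`, some `1 ≤ p < ∞` — any power-decaying vorticity profile):
  `curl U ≡ 0`; `laplacian_profile_eq_zero` (+ `div U = 0`): `ΔU ≡ 0`; `profile_eq_zero` (+ `U ∈ L^r`):
  `U ≡ 0`; `profile_const` (+ `U` bounded): `U` is constant — all by the tree's harmonic Liouville
  theorems (`eq_zero_of_harmonic_memLp_inner`, `laplacian_eq_zero_of_curl_eq_zero_of_isDivFree`,
  `eq_of_curl_eq_zero_of_isDivFree_of_bounded`), no named fact;
* `clayForce_curl_bounded` + **`curl_laplacian_profile_eq_zero_of_clayResidual[_local]`** — a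
  Clay-class force has bounded curl on `[0,∞) × ℝ³` (Fefferman (5), `n = 1`, via lit g10's slice
  lemma), so all of the above applies to every E–C design (style (β)/(β′)) whose velocity is an EXACT
  collapse ansatz on some `(t₁, T) × ℝ³` (or `× B(0, ρ)`), whatever its pressure.

READING. The E–C door (β′) in the collapse family is CLOSED AT ORDER ZERO for every exponent
`γ ≠ ½` by a theorem about the design alone — no profile equation, no Liouville-type named fact, no
pressure normalisation: an exact self-similar velocity with a Clay residual has harmonic vorticity
profile, hence (with any integrability) is irrotational, hence (div-free) harmonic, hence trivial.
Only NON-exactly-self-similar designs (the formal corrections of MEMO-2 §3 (J)) remain in the window;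
`γ = ½` (Leray; the two powers coincide) is the seat's g0 file `SelfSimilarForceVanishingNS` (force
continuous at the vertex ⇒ zero ⇒ exact Leray profile ⇒ NRŠ/Tsai).

References: P. Constantin, M. Ignatova, V. Vicol, arXiv:2602.17570 (2026), §3.1 (3.2)–(3.3)
[cite: ConstantinIgnatovaVicol2026Putative, §3.1]; A. J. Majda, A. L. Bertozzi, *Vorticity and
Incompressible Flow* (CUP 2002), §1.1–§2.1 [cite: MajdaBertozziCUP2002, §2.1 eq. (2.5)]; T.-P. Tsai,
ARMA 143 (1998), p. 49 (Liouville in `L^q`) [cite: Tsai1998, p. 49]; C. L. Fefferman, Clay problem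
description, (C), (5) [cite: FeffermanClay2006, (5)].
-/

noncomputable section

namespace Summit.NavierStokesRegularity.FluidComputer.CollapseAnsatz

open Set Filter Topology Function InnerProductSpace MeasureTheory
open scoped Laplacian RealInnerProductSpace ENNReal
open Literature.Analysis.FluidPDE

/-! ## §3 Bounded curl of the residual forces a harmonic vorticity profile -/

section Main

variable {γ T ν t₁ : ℝ} {U : EuclideanSpace ℝ (Fin 3) → EuclideanSpace ℝ (Fin 3)}
  {q : ℝ → EuclideanSpace ℝ (Fin 3) → ℝ}

/-- Pointwise core of the main theorem: a bound on the curl of the residual ALONG the curve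
`x_t = (T−t)^γ y`, `t ∈ (t₂, T)`, already forces `curl ΔU(y) = 0` and `curl N(y) = 0`. [folklore] -/
theorem curl_terms_eq_zero_at (hγ : γ ≠ 1 / 2) (hγ' : -(1 / 2) < γ) (hν : ν ≠ 0)
    {t₂ : ℝ} (ht₂ : t₂ < T) (hU : ContDiff ℝ 3 U) (hq : ∀ t ∈ Ioo t₂ T, ContDiff ℝ 2 (q t))
    {M : ℝ} (y : EuclideanSpace ℝ (Fin 3))
    (hbd : ∀ t ∈ Ioo t₂ T,
      ‖curl (fun z => timeDeriv (selfSimilarCollapse γ T U) t z +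
          convect (selfSimilarCollapse γ T U t) (selfSimilarCollapse γ T U t) z -
          ν • (Δ (selfSimilarCollapse γ T U t)) z + gradient (q t) z) ((T - t) ^ γ • y)‖ ≤ M) :
    curl (Δ U) y = 0 ∧ curl (profileInertia γ U) y = 0 := by
  have key : curl (profileInertia γ U) y = 0 ∧ -ν • curl (Δ U) y = 0 := by
    refine eq_zero_and_eq_zero_of_norm_rpow_smul_add_le (T := T) (α := -2) (β := -1 - 2 * γ)
      (M := M) ht₂ (by norm_num) (by linarith) (fun h => hγ (by linarith)) fun t ht => ?_
    have hs : 0 < T - t := sub_pos.2 ht.2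
    have hy : (T - t) ^ (-γ) • ((T - t) ^ γ • y) = y := by
      rw [smul_smul, ← Real.rpow_add hs, neg_add_cancel, Real.rpow_zero, one_smul]
    have h := hbd t ht
    rw [curl_residual_selfSimilarCollapse ht.2 hU ν (hq t ht), hy] at h
    have e : (T - t) ^ (-2 : ℝ) • curl (profileInertia γ U) y -
        (ν * (T - t) ^ (-1 - 2 * γ)) • curl (Δ U) y =
        (T - t) ^ (-2 : ℝ) • curl (profileInertia γ U) y +
          (T - t) ^ (-1 - 2 * γ) • (-ν • curl (Δ U) y) := by
      rw [smul_smul, mul_neg, mul_comm ((T - t) ^ (-1 - 2 * γ)) ν, neg_smul, sub_eq_add_neg]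
    rwa [e] at h
  refine ⟨?_, key.1⟩
  have h2 := key.2
  rw [smul_eq_zero] at h2
  exact h2.resolve_left (neg_ne_zero.2 hν)

/-- **MAIN THEOREM. An exact collapse ansatz whose residual has bounded curl has `curl ΔU ≡ 0`
and `curl N ≡ 0`.** Let `γ ≠ ½`, `γ > −½`, `ν ≠ 0`, `U ∈ C³`, and let `q(t, ·) ∈ C²` be ANY pressure
field. If the curl of the residual `∂ₜu + (u·∇)u − νΔu + ∇q` of `u = selfSimilarCollapse γ T U` is
bounded on `(t₁, T) × ℝ³`, then `curl (ΔU) = 0` and `curl (profileInertia γ U) = 0` identically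
(evaluate along `x_t = (T−t)^γ y` and apply the two-scale lemma to the powers `−2 ≠ −1−2γ`).
No named fact. [cite: ConstantinIgnatovaVicol2026Putative, §3.1 eq. (3.2)–(3.3)] -/
theorem curl_laplacian_profile_eq_zero (hγ : γ ≠ 1 / 2) (hγ' : -(1 / 2) < γ) (hν : ν ≠ 0)
    (ht₁ : t₁ < T) (hU : ContDiff ℝ 3 U) (hq : ∀ t ∈ Ioo t₁ T, ContDiff ℝ 2 (q t)) {M : ℝ}
    (hbd : ∀ t ∈ Ioo t₁ T, ∀ x,
      ‖curl (fun z => timeDeriv (selfSimilarCollapse γ T U) t z +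
          convect (selfSimilarCollapse γ T U t) (selfSimilarCollapse γ T U t) z -
          ν • (Δ (selfSimilarCollapse γ T U t)) z + gradient (q t) z) x‖ ≤ M) :
    (∀ y, curl (Δ U) y = 0) ∧ ∀ y, curl (profileInertia γ U) y = 0 :=
  ⟨fun y => (curl_terms_eq_zero_at hγ hγ' hν ht₁ hU hq y fun t ht => hbd t ht _).1,
    fun y => (curl_terms_eq_zero_at hγ hγ' hν ht₁ hU hq y fun t ht => hbd t ht _).2⟩

/-- **MAIN THEOREM, LOCAL FORM (cut-off designs).** For a POSITIVE collapse exponent `γ ≠ ½` it is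
enough that the curl of the residual be bounded on `(t₁, T) × B(0, ρ)` for some `ρ > 0` — a
neighbourhood of the singular point in space: every `x_t = (T−t)^γ y` enters the ball as `t ↑ T`.
Conclusion as before: `curl (ΔU) ≡ 0` and `curl N ≡ 0` on ALL of `ℝ³`. No named fact.
[cite: ConstantinIgnatovaVicol2026Putative, §3.1 eq. (3.2)–(3.3)] -/
theorem curl_laplacian_profile_eq_zero_local (hγ : γ ≠ 1 / 2) (hγ0 : 0 < γ) (hν : ν ≠ 0)
    (ht₁ : t₁ < T) (hU : ContDiff ℝ 3 U) (hq : ∀ t ∈ Ioo t₁ T, ContDiff ℝ 2 (q t)) {M ρ : ℝ}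
    (hρ : 0 < ρ)
    (hbd : ∀ t ∈ Ioo t₁ T, ∀ x ∈ Metric.ball (0 : EuclideanSpace ℝ (Fin 3)) ρ,
      ‖curl (fun z => timeDeriv (selfSimilarCollapse γ T U) t z +
          convect (selfSimilarCollapse γ T U t) (selfSimilarCollapse γ T U t) z -
          ν • (Δ (selfSimilarCollapse γ T U t)) z + gradient (q t) z) x‖ ≤ M) :
    (∀ y, curl (Δ U) y = 0) ∧ ∀ y, curl (profileInertia γ U) y = 0 := by
  have hγ' : -(1 / 2) < γ := by linarith
  -- for each `y`, the curve `x_t = (T−t)^γ y` is inside the ball for `t` close to `T`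
  have key : ∀ y, curl (Δ U) y = 0 ∧ curl (profileInertia γ U) y = 0 := by
    intro y
    -- the entrance time
    set δ : ℝ := (ρ / (‖y‖ + 1)) ^ (1 / γ) with hδ
    have hy1 : 0 < ‖y‖ + 1 := by positivity
    have hδ0 : 0 < δ := Real.rpow_pos_of_pos (div_pos hρ hy1) _
    set t₂ : ℝ := max t₁ (T - δ) with ht₂
    have ht₂T : t₂ < T := max_lt ht₁ (by linarith)
    have hsub : Ioo t₂ T ⊆ Ioo t₁ T := Ioo_subset_Ioo_left (le_max_left _ _)
    refine curl_terms_eq_zero_at hγ hγ' hν ht₂T hU (fun t ht => hq t (hsub ht)) (M := M) y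
      fun t ht => ?_
    refine hbd t (hsub ht) _ ?_
    have hs : 0 < T - t := sub_pos.2 ht.2
    have hsδ : T - t < δ := by
      have : T - δ < t := lt_of_le_of_lt (le_max_right _ _) ht.1
      linarith
    have hpow : (T - t) ^ γ < ρ / (‖y‖ + 1) := by
      calc (T - t) ^ γ < δ ^ γ := Real.rpow_lt_rpow hs.le hsδ hγ0
        _ = ρ / (‖y‖ + 1) := by
            rw [hδ, ← Real.rpow_mul (div_pos hρ hy1).le, one_div_mul_cancel hγ0.ne', Real.rpow_one]
    rw [Metric.mem_ball, dist_zero_right, norm_smul, Real.norm_of_nonneg (Real.rpow_nonneg hs.le γ)]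
    calc (T - t) ^ γ * ‖y‖ ≤ (T - t) ^ γ * (‖y‖ + 1) :=
          mul_le_mul_of_nonneg_left (by linarith) (Real.rpow_nonneg hs.le γ)
      _ < ρ / (‖y‖ + 1) * (‖y‖ + 1) := mul_lt_mul_of_pos_right hpow hy1
      _ = ρ := div_mul_cancel₀ ρ hy1.ne'
  exact ⟨fun y => (key y).1, fun y => (key y).2⟩

/-- **The vorticity profile is harmonic**: under the hypotheses of `curl_laplacian_profile_eq_zero`,
`Δ(curl U) ≡ 0` (`curl Δ = Δ curl` for `C³` fields, tree `curl_laplacian`). No named fact.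
[cite: MajdaBertozziCUP2002, §2.1 eq. (2.5)] -/
theorem laplacian_curl_profile_eq_zero (hγ : γ ≠ 1 / 2) (hγ' : -(1 / 2) < γ) (hν : ν ≠ 0)
    (ht₁ : t₁ < T) (hU : ContDiff ℝ 3 U) (hq : ∀ t ∈ Ioo t₁ T, ContDiff ℝ 2 (q t)) {M : ℝ}
    (hbd : ∀ t ∈ Ioo t₁ T, ∀ x,
      ‖curl (fun z => timeDeriv (selfSimilarCollapse γ T U) t z +
          convect (selfSimilarCollapse γ T U t) (selfSimilarCollapse γ T U t) z -
          ν • (Δ (selfSimilarCollapse γ T U t)) z + gradient (q t) z) x‖ ≤ M) :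
    ∀ y, (Δ (curl U)) y = 0 := fun y => by
  rw [← curl_laplacian hU y]
  exact (curl_laplacian_profile_eq_zero hγ hγ' hν ht₁ hU hq hbd).1 y

/-- **With any integrability of the vorticity profile it vanishes**: if moreover `curl U ∈ L^p(ℝ³)`
for some `1 ≤ p < ∞` (every profile whose vorticity decays at infinity with a power, e.g. the CIV
far field `|curl U| ≲ |y|^{−1/γ}`), then `curl U ≡ 0` (Liouville in `L^p` for harmonic maps, tree
`eq_zero_of_harmonic_memLp_inner`). No named fact. [cite: Tsai1998, p. 49] -/
theorem curl_profile_eq_zero (hγ : γ ≠ 1 / 2) (hγ' : -(1 / 2) < γ) (hν : ν ≠ 0)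
    (ht₁ : t₁ < T) (hU : ContDiff ℝ 3 U) (hq : ∀ t ∈ Ioo t₁ T, ContDiff ℝ 2 (q t)) {M : ℝ}
    (hbd : ∀ t ∈ Ioo t₁ T, ∀ x,
      ‖curl (fun z => timeDeriv (selfSimilarCollapse γ T U) t z +
          convect (selfSimilarCollapse γ T U t) (selfSimilarCollapse γ T U t) z -
          ν • (Δ (selfSimilarCollapse γ T U t)) z + gradient (q t) z) x‖ ≤ M)
    {p : ℝ≥0∞} (hp1 : 1 ≤ p) (hp : p ≠ ⊤) (hω : MemLp (curl U) p volume) :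
    ∀ y, curl U y = 0 := by
  have hω2 : ContDiff ℝ 2 (curl U) := contDiff_curl (n := 2) (by exact_mod_cast hU)
  have hharm : HarmonicOnNhd (curl U) univ :=
    harmonicOnNhd_of_laplacian_eq_zero hω2 (laplacian_curl_profile_eq_zero hγ hγ' hν ht₁ hU hq hbd)
  have h := eq_zero_of_harmonic_memLp_inner hharm hp1 hp hω
  exact fun y => congrFun h y

/-- **A divergence-free profile is then harmonic**: `ΔU ≡ 0` (irrotational + incompressible ⇒
harmonic, tree `laplacian_eq_zero_of_curl_eq_zero_of_isDivFree`). No named fact.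
[cite: MajdaBertozziCUP2002, §1.1 (vector identities)] -/
theorem laplacian_profile_eq_zero (hγ : γ ≠ 1 / 2) (hγ' : -(1 / 2) < γ) (hν : ν ≠ 0)
    (ht₁ : t₁ < T) (hU : ContDiff ℝ 3 U) (hdiv : VectorCalculus.IsDivFree U)
    (hq : ∀ t ∈ Ioo t₁ T, ContDiff ℝ 2 (q t)) {M : ℝ}
    (hbd : ∀ t ∈ Ioo t₁ T, ∀ x,
      ‖curl (fun z => timeDeriv (selfSimilarCollapse γ T U) t z +
          convect (selfSimilarCollapse γ T U t) (selfSimilarCollapse γ T U t) z -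
          ν • (Δ (selfSimilarCollapse γ T U t)) z + gradient (q t) z) x‖ ≤ M)
    {p : ℝ≥0∞} (hp1 : 1 ≤ p) (hp : p ≠ ⊤) (hω : MemLp (curl U) p volume) :
    ∀ y, (Δ U) y = 0 :=
  laplacian_eq_zero_of_curl_eq_zero_of_isDivFree (hU.of_le (by norm_cast))
    (curl_profile_eq_zero hγ hγ' hν ht₁ hU hq hbd hp1 hp hω) hdiv

/-- **… and trivial if it has any integrability itself**: `U ∈ L^r(ℝ³)` for some `1 ≤ r < ∞` forces
`U ≡ 0`. No named fact. [cite: Tsai1998, p. 49] -/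
theorem profile_eq_zero (hγ : γ ≠ 1 / 2) (hγ' : -(1 / 2) < γ) (hν : ν ≠ 0)
    (ht₁ : t₁ < T) (hU : ContDiff ℝ 3 U) (hdiv : VectorCalculus.IsDivFree U)
    (hq : ∀ t ∈ Ioo t₁ T, ContDiff ℝ 2 (q t)) {M : ℝ}
    (hbd : ∀ t ∈ Ioo t₁ T, ∀ x,
      ‖curl (fun z => timeDeriv (selfSimilarCollapse γ T U) t z +
          convect (selfSimilarCollapse γ T U t) (selfSimilarCollapse γ T U t) z -
          ν • (Δ (selfSimilarCollapse γ T U t)) z + gradient (q t) z) x‖ ≤ M)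
    {p : ℝ≥0∞} (hp1 : 1 ≤ p) (hp : p ≠ ⊤) (hω : MemLp (curl U) p volume)
    {r : ℝ≥0∞} (hr1 : 1 ≤ r) (hr : r ≠ ⊤) (hUr : MemLp U r volume) : U = 0 := by
  have hU2 : ContDiff ℝ 2 U := hU.of_le (by norm_cast)
  have hharm : HarmonicOnNhd U univ := harmonicOnNhd_of_laplacian_eq_zero hU2
    (laplacian_profile_eq_zero hγ hγ' hν ht₁ hU hdiv hq hbd hp1 hp hω)
  exact eq_zero_of_harmonic_memLp_inner hharm hr1 hr hUr

/-- **… or constant if it is bounded** (bounded irrotational incompressible fields are constant,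
tree `eq_of_curl_eq_zero_of_isDivFree_of_bounded`). No named fact.
[cite: MajdaBertozziCUP2002, §1.1 (vector identities)] -/
theorem profile_const (hγ : γ ≠ 1 / 2) (hγ' : -(1 / 2) < γ) (hν : ν ≠ 0)
    (ht₁ : t₁ < T) (hU : ContDiff ℝ 3 U) (hdiv : VectorCalculus.IsDivFree U)
    (hq : ∀ t ∈ Ioo t₁ T, ContDiff ℝ 2 (q t)) {M : ℝ}
    (hbd : ∀ t ∈ Ioo t₁ T, ∀ x,
      ‖curl (fun z => timeDeriv (selfSimilarCollapse γ T U) t z +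
          convect (selfSimilarCollapse γ T U t) (selfSimilarCollapse γ T U t) z -
          ν • (Δ (selfSimilarCollapse γ T U t)) z + gradient (q t) z) x‖ ≤ M)
    {p : ℝ≥0∞} (hp1 : 1 ≤ p) (hp : p ≠ ⊤) (hω : MemLp (curl U) p volume)
    {B : ℝ} (hB : ∀ y, ‖U y‖ ≤ B) : ∀ y y', U y = U y' :=
  eq_of_curl_eq_zero_of_isDivFree_of_bounded (hU.of_le (by norm_cast))
    (curl_profile_eq_zero hγ hγ' hν ht₁ hU hq hbd hp1 hp hω) hdiv hB

end Main

/-! ## §4 The E–C reading: Clay forces have bounded curl -/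

section Clay

/-- **A Clay-class force has bounded curl on the closed half-space**: `‖curl f(t,·)(x)‖ ≤ M` for
`t ≥ 0` (slice derivative ≤ joint derivative, lit g10's `IsSmoothOnHalfSpace.norm_iteratedFDeriv_slice_le`;
then the `n = 1`, `K = 0` instance of Fefferman's decay (5)). [cite: FeffermanClay2006, (5)] -/
theorem clayForce_curl_bounded {f : ℝ → EuclideanSpace ℝ (Fin 3) → EuclideanSpace ℝ (Fin 3)}
    (hs : IsSmoothOnHalfSpace f) (hd : HasRapidSpaceTimeDecay f) :
    ∃ M : ℝ, ∀ t, 0 ≤ t → ∀ x, ‖curl (f t) x‖ ≤ M := by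
  obtain ⟨C, hC⟩ := hd 1 0
  refine ⟨‖curlCLM‖ * C, fun t ht x => ?_⟩
  have h1 := hC t ht x
  rw [pow_zero, one_mul] at h1
  have h2 := hs.norm_iteratedFDeriv_slice_le 1 ht x
  rw [norm_iteratedFDeriv_one] at h2
  exact (norm_curl_le (f t) x).trans (mul_le_mul_of_nonneg_left (h2.trans h1) (norm_nonneg curlCLM))

variable {γ T ν t₁ : ℝ} {U : EuclideanSpace ℝ (Fin 3) → EuclideanSpace ℝ (Fin 3)}
  {q : ℝ → EuclideanSpace ℝ (Fin 3) → ℝ}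

/-- **THE EXACT COLLAPSE ANSATZ IS NEVER AN E–C DESIGN AT ORDER ZERO (`γ ≠ ½`, any pressure).**
If a Clay-class force `F` (smooth on `[0,∞) × ℝ³` with Fefferman's decay (5)) agrees on
`(t₁, T) × ℝ³`, `0 ≤ t₁ < T`, with the residual `∂ₜu + (u·∇)u − νΔu + ∇q(t)` of the EXACT collapse
ansatz `u = selfSimilarCollapse γ T U` (`U ∈ C³`, `ν ≠ 0`, `γ ≠ ½`, `γ > −½`) with ANY `C²` pressures
`q(t)`, then `curl ΔU ≡ 0` and `curl N ≡ 0` — the vorticity profile is harmonic; with the corollaries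
above (`curl U ∈ L^p` ⇒ irrotational; div-free ⇒ `ΔU ≡ 0`; `U ∈ L^r` ⇒ `U ≡ 0`). No named fact.
[cite: FeffermanClay2006, (C) (5)] [cite: ConstantinIgnatovaVicol2026Putative, §3.1] -/
theorem curl_laplacian_profile_eq_zero_of_clayResidual (hγ : γ ≠ 1 / 2) (hγ' : -(1 / 2) < γ)
    (hν : ν ≠ 0) (ht₁0 : 0 ≤ t₁) (ht₁ : t₁ < T) (hU : ContDiff ℝ 3 U)
    (hq : ∀ t ∈ Ioo t₁ T, ContDiff ℝ 2 (q t))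
    {F : ℝ → EuclideanSpace ℝ (Fin 3) → EuclideanSpace ℝ (Fin 3)}
    (hFs : IsSmoothOnHalfSpace F) (hFd : HasRapidSpaceTimeDecay F)
    (hres : ∀ t ∈ Ioo t₁ T, ∀ x, F t x =
      timeDeriv (selfSimilarCollapse γ T U) t x +
        convect (selfSimilarCollapse γ T U t) (selfSimilarCollapse γ T U t) x -
        ν • (Δ (selfSimilarCollapse γ T U t)) x + gradient (q t) x) :
    (∀ y, curl (Δ U) y = 0) ∧ ∀ y, curl (profileInertia γ U) y = 0 := by
  obtain ⟨M, hM⟩ := clayForce_curl_bounded hFs hFd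
  refine curl_laplacian_profile_eq_zero hγ hγ' hν ht₁ hU hq (M := M) fun t ht x => ?_
  have hfun : (fun z => timeDeriv (selfSimilarCollapse γ T U) t z +
      convect (selfSimilarCollapse γ T U t) (selfSimilarCollapse γ T U t) z -
      ν • (Δ (selfSimilarCollapse γ T U t)) z + gradient (q t) z) = F t :=
    funext fun z => (hres t ht z).symm
  rw [hfun]
  exact hM t (ht₁0.trans ht.1.le) x

/-- **Local form for cut-off designs (`γ > 0`).** If a Clay-class force agrees with the residual of
the exact collapse ansatz only on `(t₁, T) × B(0, ρ)` — the ansatz being used near the singular point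
and glued to anything outside — the same conclusion holds: `curl ΔU ≡ 0` and `curl N ≡ 0` on all of
`ℝ³`. No named fact. [cite: FeffermanClay2006, (C) (5)] [cite: ConstantinIgnatovaVicol2026Putative, §3.1] -/
theorem curl_laplacian_profile_eq_zero_of_clayResidual_local (hγ : γ ≠ 1 / 2) (hγ0 : 0 < γ)
    (hν : ν ≠ 0) (ht₁0 : 0 ≤ t₁) (ht₁ : t₁ < T) (hU : ContDiff ℝ 3 U)
    (hq : ∀ t ∈ Ioo t₁ T, ContDiff ℝ 2 (q t)) {ρ : ℝ} (hρ : 0 < ρ)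
    {F : ℝ → EuclideanSpace ℝ (Fin 3) → EuclideanSpace ℝ (Fin 3)}
    (hFs : IsSmoothOnHalfSpace F) (hFd : HasRapidSpaceTimeDecay F)
    (hres : ∀ t ∈ Ioo t₁ T, ∀ x ∈ Metric.ball (0 : EuclideanSpace ℝ (Fin 3)) ρ, F t x =
      timeDeriv (selfSimilarCollapse γ T U) t x +
        convect (selfSimilarCollapse γ T U t) (selfSimilarCollapse γ T U t) x -
        ν • (Δ (selfSimilarCollapse γ T U t)) x + gradient (q t) x) :
    (∀ y, curl (Δ U) y = 0) ∧ ∀ y, curl (profileInertia γ U) y = 0 := by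
  obtain ⟨M, hM⟩ := clayForce_curl_bounded hFs hFd
  refine curl_laplacian_profile_eq_zero_local hγ hγ0 hν ht₁ hU hq (M := M) hρ fun t ht x hx => ?_
  -- the two fields agree on the open ball, a neighbourhood of `x`, so their curls agree at `x`
  have hnhds : (fun z => timeDeriv (selfSimilarCollapse γ T U) t z +
      convect (selfSimilarCollapse γ T U t) (selfSimilarCollapse γ T U t) z -
      ν • (Δ (selfSimilarCollapse γ T U t)) z + gradient (q t) z) =ᶠ[𝓝 x] F t := by
    filter_upwards [Metric.isOpen_ball.mem_nhds hx] with z hz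
    exact (hres t ht z hz).symm
  rw [curl_eq_curlCLM, hnhds.fderiv_eq, ← curl_eq_curlCLM]
  exact hM t (ht₁0.trans ht.1.le) x

end Clay

end Summit.NavierStokesRegularity.FluidComputer.CollapseAnsatz

end
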